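import Mathlib.LinearAlgebra.Alternating.Basic
import Mathlib.LinearAlgebra.Matrix.Determinant.Basic
import Mathlib.Data.Fin.VecNotation
import Mathlib.Analysis.SpecialFunctions.Log.Basic
import Literature.Geometry.Lorentzian.Basic
import Literature.Geometry.Lorentzian.LorentzianMetric
import Literature.Geometry.Lorentzian.LeviCivita
import Literature.Geometry.Lorentzian.Isometry
import Literature.Geometry.Lorentzian.StaticBlackHoleUniqueness
import HarnessLib

/-!
# The Geroch–Moncrief `U(1)` reduction along a spacelike Killing field

Definition request `defn-U1Reduction` of route `FinalStateConjecture/NoVacuumStrings` (informal items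
`ClosedStringsTrapped`, `SubcriticalStringsDisperse`): for a spacetime `(Z, g)` with a Killing field `K`
which is spacelike and nowhere zero on an open set, the objects of the reduction of the vacuum Einstein
equations along `K` — the norm `λ = e^{2γ} = g(K, K)`, the twist 1-form `⋆(K♭ ∧ dK♭)` and its potential
`ω`, the quotient Lorentzian `3`-metric `g₃ = λ g − K♭ ⊗ K♭` on a local slice transverse to `K`, the
hyperbolic target metric `2 dγ² + ½ e^{−4γ} dω²` on `ℝ²` — and the **reduction identity**: `Ric(g) = 0`
iff `(g₃, (γ, ω))` solves the `2+1` Einstein–wave-map system (Geroch 1971; Moncrief 1986;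
Choquet-Bruhat–Moncrief 2001, §2; Gudapati 2013, Ch. 2; Andersson–Gudapati–Szeftel 2017, §1.2).

## The printed statements

* Wald 1984, §7.1, (7.1.8): the **twist** of a Killing field `ξ` is `ω_a = ε_{abcd} ξ^b ∇^c ξ^d`,
  `ε` the volume element of `g`; (7.1.15): `∇_{[a} ω_{b]} = −ε_{abcd} ξ^c R^d{}_e ξ^e`; §7.4,
  (7.4.1)–(7.4.3): in a vacuum spacetime `∇_{[a} ω_{b]} = 0`, hence locally `ω_a = ∇_a ω` (the
  **scalar twist**); (7.4.9): `λ = ξ^c ξ_c`; App. B, (B.2.9)/(B.2.12): the metric volume element is fixed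
  up to sign by `ε^{a₁…aₙ} ε_{b₁…bₙ} = (−1)^s n! δ^{[a₁}_{b₁} ⋯ δ^{aₙ]}_{bₙ}`, `s = 1` for Lorentzian `g`.
* Choquet-Bruhat–Moncrief 2001, §2: on a principal bundle with spacelike one-dimensional fibres the
  metric reads `⁽⁴⁾g = e^{−2γ} ⁽³⁾g + e^{2γ} θ²`, `θ = dx³ + A_α dx^α`; §2.1: the curvature `F = dA`
  is `⋆`-dual to a 1-form which is closed iff `⁽⁴⁾R_{α3} = 0`, whence the **twist potential** `ω`;
  §2.2: `F` closed and `⁽⁴⁾R_{33} = 0` say that `u = (γ, ω)` is a **wave map** from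
  `(Σ × ℝ, ⁽³⁾g)` into `ℝ²` with the (hyperbolic) metric printed there as `2 (dγ)² + ½ e^{4γ} (dω)²`
  (with `e^{2γ} = ⁽⁴⁾g(∂₃, ∂₃)` the weight is `e^{−4γ}`, as in Gudapati's detailed derivation with the
  same convention and as checked under "Normalisations" below; the two differ by `γ ↦ −γ`); §2.3,
  eq. (1): then `⁽⁴⁾R_{αβ} = 0` is equivalent to `⁽³⁾R_{αβ} = ∂_α u · ∂_β u` (dot = target metric).
* Gudapati 2013 (arXiv:1311.4495), Ch. 2, pp. 14–15: the same computation in detail — Kaluza–Klein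
  decomposition of `Ric(ḡ)` for `ḡ = g̃ + e^{2ψ} θ²`, `G := e^{3ψ} ⋆̃F` closed iff `R̄_{μ3} = 0`,
  `G = dω`, conformal metric `g = e^{2ψ} g̃`, and the **Einstein–wave-map system**
  `R_{μν} = ½ (e^{−4ψ} ∂_μω ∂_νω + 4 ∂_μψ ∂_νψ) = ⟨∂_μU, ∂_νU⟩_h`,
  `□_g ψ + ½ e^{−4ψ} g^{μν} ∂_μω ∂_νω = 0`, `□_g ω − 4 g^{μν} ∂_μψ ∂_νω = 0`, target
  `h = 2 dρ² + ½ e^{−4ρ} dϑ²` (`Γ¹₂₂ = ½ e^{−4ρ}`, `Γ²₁₂ = −2`).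
* Andersson–Gudapati–Szeftel 2017, §1.2 and Remark 1.2: the Einstein–wave-map system
  `G_{μν} = κ S_{μν}`, `S` the wave-map stress tensor; "the 3+1 vacuum Einstein equations with a
  spacelike translational Killing field reduce to a 2+1 dimensional Einstein–wave map system with
  target the hyperbolic plane" (Moncrief 1986).

## Main definitions (namespace `Literature.Geometry.Lorentzian`)

* `U1Reduction.targetMetric p` — the hyperbolic target metric `h_{(γ,ω)}(a, b) = 2 a₁ b₁ + ½ e^{−4γ} a₂ b₂`
  on `ℝ × ℝ` (positive definite, `targetMetric_self_pos`; Gauss curvature `−2`).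
* `PseudoRiemannianMetric.sqNorm g K x = g(K, K)` (`λ`), `normPotential g K x = ½ log g(K, K)` (`γ`,
  so `e^{2γ} = λ` where `λ > 0`, `exp_two_mul_normPotential`).
* `PseudoRiemannianMetric.orbitBilin g K x` — Geroch's orbit-space metric lifted to `Z`,
  `h = g − λ⁻¹ K♭ ⊗ K♭`; `reducedBilin g K x` — Moncrief's `g₃ = λ h = λ g − K♭ ⊗ K♭` (the conformal
  quotient metric `e^{2ψ} g̃` of Gudapati), both `K`-degenerate symmetric bilinear forms on `T_x Z`.
* `PseudoRiemannianMetric.IsMetricVolumeForm g x ε` — `ε` is a metric volume form of the Lorentzian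
  metric `g_x` (Wald (B.2.12), contracted: `ε(u) ε(v) = −det g(uᵢ, vⱼ)`);
  `IsTwistCovector g K x ε ϖ` — `ϖ` is the twist 1-form of `K` at `x`: `(K♭ ∧ dK♭)(u,v,w) = ε(u,v,w,ϖ♯)`
  (the `3`-form `K♭ ∧ dK♭` is the prelude's `twistForm`); `twistCovector` (the 1-form, by choice);
  `IsTwistPotentialOn g K ε f U` — `df = ϖ` on `U`.
* `PseudoRiemannianMetric.IsReducedSlice g K φ g₃` — `(N, g₃) —φ→ Z` is a local slice transverse to `K`
  carrying the quotient metric: `φ` smooth, `dim N + 1 = dim Z`, `φ^*(λ g − K♭ ⊗ K♭) = g₃`.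
* `PseudoRiemannianMetric.IsEinsteinWaveMapAt g₃ γ ω y`, `IsEinsteinWaveMap` — the Einstein–wave-map
  system with target `(ℝ², h)` (Ricci form, `κ = 1`) for a metric `g₃` and a map `(γ, ω)`.
* Named facts (D-0014) on `LorentzianMetric`: `exists_twistPotential` (Wald (7.4.2)–(7.4.3)),
  `ricci_eq_zero_iff_isEinsteinWaveMapAt` (**the reduction identity**, pointwise along any reduced
  slice), `exists_isReducedSlice` (local reduced slices exist where `λ > 0`); and the proved corollary
  `isEinsteinWaveMapAt_of_isRicciFlat`.

## Design choices

* **No quotient manifolds.** Following the request, the orbit space is never built: `λ`, `γ`, `h`, `g₃`,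
  the twist are `K`-invariant tensors *on `Z`* (Geroch's calculus), and the `2+1` objects live on an
  arbitrary **local slice** `φ : N → Z` transverse to `K` (`IsReducedSlice`), onto which `g₃` is pulled
  back with the prelude's `pullbackBilin`; `λ g − K♭ ⊗ K♭` has `K` in its kernel
  (`reducedBilin_apply_self_left`) and is invariant under `u ↦ u + c K` (`reducedBilin_add_smul_left`),
  so every slice sees the orbit-space metric. The identity is stated **pointwise**: `Ric(g)_{φ y} = 0` iff
  the system holds at `y` — this is what the Kaluza–Klein formulas (Gudapati Ch. 2) give.
* **Orientation as data.** The twist 1-form is a pseudo-form: it needs a metric volume form `ε`, taken as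
  a datum characterised algebraically (`IsMetricVolumeForm`, dimension `4`, Lorentzian sign); no
  smoothness of `ε` is asserted or needed (a twist potential `f` with `df = ϖ(ε)` of class `C^∞` is
  hypothesised instead; `exists_twistPotential` produces `ε` together with `f`). Replacing `ε` by `−ε`
  replaces `ϖ, f` by `−ϖ, −f` (`IsTwistCovector.neg`), an isometry of the target.
* **Normalisations.** `γ = ½ log λ` and `ω` = Wald's scalar twist (`∇ω = ε_{abcd} ξ^b ∇^c ξ^d`); with
  these the target metric is `h = 2 dγ² + ½ e^{−4γ} dω²` and `Ric(g₃) = h(∂u, ∂u)` exactly as printed by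
  Choquet-Bruhat–Moncrief (§2.2–2.3) and Gudapati (Ch. 2) (one checks `ω_a = ± e^{3ψ}(⋆̃F)_a` for
  `ḡ = g̃ + e^{2ψ} θ²`, `ξ = ∂₃`). The request's `dγ² + ¼ e^{−4γ} dω²` (curvature `−4`) is `h/2`, for
  which the Einstein equation reads `Ric(g₃) = 2 h'(∂u, ∂u)`; the wave-map equations are insensitive to
  the factor. `e^{2γ} = g(K,K)` as in the request and in `⁽⁴⁾g = e^{−2γ} ⁽³⁾g + e^{2γ} θ²`.
* **Regularity.** The facts are stated in the smooth category (`C^∞` metrics, as in the sources) on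
  boundaryless manifolds; the predicates are regularity-agnostic. `□`, `Hess`, `♯`, `g⁻¹` are the
  prelude's `dalembertian`, `hessian`, `sharp`, `innerDual`; `d` of a function is Mathlib's `mvfderiv`.
  The second component of the wave map is written `ϑ` in binders (`ω` is Mathlib notation for
  analyticity); it is the twist potential `ω` of the sources.
* **Not here.** The transverse energy and its deficit normalisation (request D2 `TransverseEnergy`);
  the global orbit space / principal-bundle picture and the reconstruction of `⁽⁴⁾g` from
  `(g₃, γ, ω)` (gauge `A`); Geroch's unrescaled equations for `(h, λ, ω_a)`; matter.

## References

* R. Geroch, *A method for generating solutions of Einstein's equations*, J. Math. Phys. 12 (1971)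
  918–924, §2 and App. A (key `Geroch1971`; original source of `λ`, `ω_a`, `h_{ab}`; paywalled here, read
  through Wald 1984 §7.1, §7.4).
* V. Moncrief, *Reduction of Einstein's equations for vacuum space-times with spacelike U(1) isometry
  groups*, Ann. Phys. 167 (1986) 118–142, §2 (key `Moncrief1986`; original source of the
  Einstein–wave-map form; read through the three following items).
* Y. Choquet-Bruhat, V. Moncrief, Ann. Henri Poincaré 2 (2001) 1007–1064 = arXiv:gr-qc/0112049, §2
  (key `ChoquetbruhatMoncrief2001`).
* N. Gudapati, *On the Cauchy problem for energy critical self-gravitating wave maps*, thesis (FU Berlin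
  2013) = arXiv:1311.4495, Ch. 2 (key `Gudapati2013`).
* L. Andersson, N. Gudapati, J. Szeftel, Ann. PDE 3 (2017) 13 = arXiv:1501.00616, §1.2, Remark 1.2
  (key `AnderssonGudapatiSzeftel2017`).
* R. M. Wald, *General Relativity*, Chicago 1984, §7.1 (7.1.8), (7.1.15), §7.4 (7.4.1)–(7.4.3), (7.4.9),
  App. B (B.2.9), (B.2.12)–(B.2.13) (key `Wald1984GR`).
-/

noncomputable section

open Bundle Set Manifold TopologicalSpace
open scoped ContDiff Topology Manifold

namespace Literature.Geometry.Lorentzian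

/-! ### The hyperbolic target plane -/

namespace U1Reduction

/-- The **target metric** of the `U(1)` reduction: the Riemannian metric
`h_{(γ, ω)}(a, b) = 2 a₁ b₁ + ½ e^{−4γ} a₂ b₂`, i.e. `h = 2 dγ² + ½ e^{−4γ} dω²`, on the plane `ℝ × ℝ`
with coordinates `(γ, ω)`, as a bilinear form depending on the base point `p = (γ, ω)`. It is a
hyperbolic plane (Gauss curvature `−2`; the normalisation `dγ² + ¼ e^{−4γ} dω² = h/2` has curvature
`−4`). Gudapati 2013, Ch. 2, p. 14 (`ds²_h = 2 dρ² + ½ e^{−4ρ} dϑ²`); Choquet-Bruhat–Moncrief 2001, §2.2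
(printed with `e^{4γ}`, see the module docstring). [cite: Gudapati2013, Ch. 2, p. 14] -/
def targetMetric (p : ℝ × ℝ) : LinearMap.BilinForm ℝ (ℝ × ℝ) :=
  LinearMap.mk₂ ℝ (fun a b ↦ 2 * a.1 * b.1 + Real.exp (-4 * p.1) / 2 * a.2 * b.2)
    (fun a a' b ↦ by simp only [Prod.fst_add, Prod.snd_add]; ring)
    (fun c a b ↦ by simp only [Prod.smul_fst, Prod.smul_snd, smul_eq_mul]; ring)
    (fun a b b' ↦ by simp only [Prod.fst_add, Prod.snd_add]; ring)
    (fun c a b ↦ by simp only [Prod.smul_fst, Prod.smul_snd, smul_eq_mul]; ring)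

/-- Unfolding lemma: `h_{(γ,ω)}(a, b) = 2 a₁ b₁ + ½ e^{−4γ} a₂ b₂`. Gudapati 2013, Ch. 2, p. 14.
[cite: Gudapati2013, Ch. 2, p. 14] -/
@[simp]
lemma targetMetric_apply (p a b : ℝ × ℝ) :
    targetMetric p a b = 2 * a.1 * b.1 + Real.exp (-4 * p.1) / 2 * a.2 * b.2 := rfl

/-- The target metric is symmetric. [folklore] -/
lemma targetMetric_comm (p a b : ℝ × ℝ) : targetMetric p a b = targetMetric p b a := by
  simp only [targetMetric_apply]; ring

/-- The target metric is positive semidefinite. [folklore] -/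
lemma targetMetric_self_nonneg (p a : ℝ × ℝ) : 0 ≤ targetMetric p a a := by
  have he := Real.exp_pos (-4 * p.1)
  simp only [targetMetric_apply]
  nlinarith [mul_self_nonneg a.1, mul_self_nonneg a.2]

/-- The target metric is positive definite (a Riemannian metric on `ℝ²`).
Choquet-Bruhat–Moncrief 2001, §2.2 ("riemannian metric"). [cite: ChoquetbruhatMoncrief2001, §2.2] -/
lemma targetMetric_self_pos (p : ℝ × ℝ) {a : ℝ × ℝ} (ha : a ≠ 0) : 0 < targetMetric p a a := by
  have he := Real.exp_pos (-4 * p.1)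
  simp only [targetMetric_apply]
  by_cases h : a.1 = 0
  · have h2 : a.2 ≠ 0 := fun h2 ↦ ha (Prod.ext h h2)
    have h2' : 0 < a.2 * a.2 := mul_self_pos.mpr h2
    nlinarith [mul_self_nonneg a.1]
  · have h1 : 0 < a.1 * a.1 := mul_self_pos.mpr h
    nlinarith [mul_self_nonneg a.2]

end U1Reduction

namespace PseudoRiemannianMetric

variable {E : Type*} [NormedAddCommGroup E] [NormedSpace ℝ E] {H : Type*} [TopologicalSpace H]
  {I : ModelWithCorners ℝ E H} {M : Type*} [TopologicalSpace M] [ChartedSpace H M]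
  [IsManifold I ∞ M] {n : ℕ∞ω}

/-! ### Norm, norm potential, orbit-space and reduced bilinear forms -/

section Algebra

variable (g : PseudoRiemannianMetric I n E (TangentSpace I : M → Type _))
  (K : Π x : M, TangentSpace I x)

/-- The **squared norm** `λ(x) = g_x(K, K)` of the vector field `K` (Geroch's `λ`; `λ > 0` says that `K`
is spacelike and nonzero at `x`). Wald 1984, (7.4.9); Geroch 1971, §2. [cite: Wald1984GR, (7.4.9)] -/
def sqNorm (x : M) : ℝ :=
  g.val x (K x) (K x)

/-- The **norm potential** `γ(x) = ½ log g_x(K, K)`, so that `e^{2γ} = g(K, K)` where `K` is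
spacelike and nonzero (`exp_two_mul_normPotential`); junk (`log` of a nonpositive number) elsewhere.
Choquet-Bruhat–Moncrief 2001, §2 (`⁽⁴⁾g = e^{−2γ} ⁽³⁾g + e^{2γ} θ²`, so `e^{2γ} = ⁽⁴⁾g(∂₃, ∂₃)`);
Gudapati 2013, Ch. 2 (`ψ`). [cite: ChoquetbruhatMoncrief2001, §2] -/
def normPotential (x : M) : ℝ :=
  Real.log (g.sqNorm K x) / 2

/-- Unfolding lemma for `sqNorm`. [folklore] -/
@[simp]
lemma sqNorm_apply (x : M) : g.sqNorm K x = g.val x (K x) (K x) := rfl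

/-- `e^{2γ} = g(K, K)` where `g(K, K) > 0`. Choquet-Bruhat–Moncrief 2001, §2. [cite: ChoquetbruhatMoncrief2001, §2] -/
lemma exp_two_mul_normPotential {x : M} (h : 0 < g.sqNorm K x) :
    Real.exp (2 * g.normPotential K x) = g.sqNorm K x := by
  rw [normPotential, mul_div_cancel₀ _ two_ne_zero, Real.exp_log h]

/-- `e^{−4γ} = λ⁻²` where `λ = g(K, K) > 0` (the weight of `dω²` in the target metric in terms of
Geroch's `λ`). [folklore] -/
lemma exp_neg_four_mul_normPotential {x : M} (h : 0 < g.sqNorm K x) :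
    Real.exp (-4 * g.normPotential K x) = (g.sqNorm K x ^ 2)⁻¹ := by
  rw [show -4 * g.normPotential K x = -(2 * g.normPotential K x) + -(2 * g.normPotential K x) by ring,
    Real.exp_add, Real.exp_neg, exp_two_mul_normPotential g K h]
  ring

/-- **Geroch's orbit-space metric lifted to `Z`**: the bilinear form
`h_x(u, v) = g(u, v) − λ⁻¹ g(K, u) g(K, v)`, `λ = g(K, K)`, i.e. `h_{ab} = g_{ab} − λ⁻¹ ξ_a ξ_b`, written
as `g_x(P u, v)` for `P u = u − λ⁻¹ g(K, u) K` (the projector off `K`); it is the metric induced on the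
space of `K`-orbits (junk value `g` itself where `λ = 0`, by `0⁻¹ = 0`). Geroch 1971, App. A; Wald 1984,
§7.1 (projection orthogonal to a Killing field). [cite: Geroch1971, App. A] -/
def orbitBilin (x : M) : TangentSpace I x →L[ℝ] TangentSpace I x →L[ℝ] ℝ :=
  (g.val x).comp (ContinuousLinearMap.id ℝ (TangentSpace I x) -
    (g.sqNorm K x)⁻¹ • (g.val x (K x)).smulRight (K x))

/-- **The reduced (conformal quotient) metric lifted to `Z`**: the bilinear form
`(g₃)_x(u, v) = λ g(u, v) − g(K, u) g(K, v) = e^{2γ} (g − e^{−2γ} K♭ ⊗ K♭)(u, v)`, written as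
`g_x(λ u − g(K, u) K, v)`. It is `λ` times Geroch's `h` (`reducedBilin_eq_smul_orbitBilin`), has `K` in
its kernel and is invariant under `u ↦ u + c K`; pulled back to a slice transverse to `K` it is the
Lorentzian `3`-metric `⁽³⁾g` of `⁽⁴⁾g = e^{−2γ} ⁽³⁾g + e^{2γ} θ²` (Choquet-Bruhat–Moncrief 2001, §2), the
conformal metric `g = e^{2ψ} g̃` of Gudapati 2013, Ch. 2, in which the reduced system is an
Einstein–wave-map system. [cite: ChoquetbruhatMoncrief2001, §2] -/
def reducedBilin (x : M) : TangentSpace I x →L[ℝ] TangentSpace I x →L[ℝ] ℝ :=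
  (g.val x).comp (g.sqNorm K x • ContinuousLinearMap.id ℝ (TangentSpace I x) -
    (g.val x (K x)).smulRight (K x))

variable {g K}

/-- `h_x(u, v) = g(u, v) − λ⁻¹ g(K, u) g(K, v)`. Geroch 1971, App. A. [cite: Geroch1971, App. A] -/
@[simp]
lemma orbitBilin_apply (x : M) (u v : TangentSpace I x) :
    g.orbitBilin K x u v = g.val x u v - (g.sqNorm K x)⁻¹ * g.val x (K x) u * g.val x (K x) v := by
  simp [orbitBilin, mul_assoc]

/-- `(g₃)_x(u, v) = λ g(u, v) − g(K, u) g(K, v)`. Choquet-Bruhat–Moncrief 2001, §2. [cite: ChoquetbruhatMoncrief2001, §2] -/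
@[simp]
lemma reducedBilin_apply (x : M) (u v : TangentSpace I x) :
    g.reducedBilin K x u v = g.sqNorm K x * g.val x u v - g.val x (K x) u * g.val x (K x) v := by
  simp [reducedBilin]

/-- `g₃ = λ h` where `λ = g(K, K) ≠ 0`. Geroch 1971, App. A; Gudapati 2013, Ch. 2 (`g = e^{2ψ} g̃`).
[cite: Gudapati2013, Ch. 2] -/
lemma reducedBilin_eq_smul_orbitBilin {x : M} (h : g.sqNorm K x ≠ 0) (u v : TangentSpace I x) :
    g.reducedBilin K x u v = g.sqNorm K x * g.orbitBilin K x u v := by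
  rw [reducedBilin_apply, orbitBilin_apply, mul_sub, ← mul_assoc, ← mul_assoc, mul_inv_cancel₀ h,
    one_mul]

/-- `K` is in the kernel of the reduced metric: `g₃(K, v) = 0`. Geroch 1971, App. A
(`h_{ab} ξ^b = 0`). [cite: Geroch1971, App. A] -/
@[simp]
lemma reducedBilin_apply_self_left (x : M) (v : TangentSpace I x) :
    g.reducedBilin K x (K x) v = 0 := by
  simp [g.symm x (K x) v, mul_comm]

/-- `g₃(u, K) = 0`. Geroch 1971, App. A (`h_{ab} ξ^b = 0`). [cite: Geroch1971, App. A] -/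
@[simp]
lemma reducedBilin_apply_self_right (x : M) (u : TangentSpace I x) :
    g.reducedBilin K x u (K x) = 0 := by
  simp [g.symm x u (K x), mul_comm]

/-- The reduced metric is symmetric. [folklore] -/
lemma reducedBilin_comm (x : M) (u v : TangentSpace I x) :
    g.reducedBilin K x u v = g.reducedBilin K x v u := by
  simp only [reducedBilin_apply, g.symm x u v, g.symm x (K x) u, g.symm x (K x) v]; ring

/-- The reduced metric only depends on vectors modulo `K`: `g₃(u + c K, v) = g₃(u, v)` (it is the lift
of a tensor on the orbit space). Geroch 1971, App. A. [cite: Geroch1971, App. A] -/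
lemma reducedBilin_add_smul_left (x : M) (c : ℝ) (u v : TangentSpace I x) :
    g.reducedBilin K x (u + c • K x) v = g.reducedBilin K x u v := by
  rw [map_add, map_smul]
  change g.reducedBilin K x u v + c • g.reducedBilin K x (K x) v = _
  rw [reducedBilin_apply_self_left, smul_zero, add_zero]

end Algebra

/-! ### Metric volume forms, the twist 1-form and twist potentials (dimension `4`) -/

section Twist

variable (g : PseudoRiemannianMetric I n E (TangentSpace I : M → Type _))
  (K : Π x : M, TangentSpace I x)

/-- `ε` is a **metric volume form** of the (Lorentzian, `4`-dimensional) scalar product `g_x`: an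
alternating `4`-form on `T_x M` with `ε(u₁,…,u₄) ε(v₁,…,v₄) = −det (g_x(uᵢ, vⱼ))` for all `u, v` —
Wald's normalisation `ε^{a₁…a₄} ε_{b₁…b₄} = (−1)^s 4! δ^{[a₁}_{b₁} ⋯ δ^{a₄]}_{b₄}` with `s = 1`,
contracted with the vectors; equivalently `ε = ±1` on `g_x`-orthonormal frames. It determines `ε` up to
sign (the two orientations). Wald 1984, App. B, (B.2.9), (B.2.12), (B.2.14). [cite: Wald1984GR, App. B (B.2.9), (B.2.12)] -/
def IsMetricVolumeForm (x : M) (ε : TangentSpace I x [⋀^Fin 4]→ₗ[ℝ] ℝ) : Prop :=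
  ∀ u v : Fin 4 → TangentSpace I x, ε u * ε v = -(Matrix.of fun i j ↦ g.val x (u i) (v j)).det

variable {g} in
/-- `−ε` is a metric volume form when `ε` is (the opposite orientation). Wald 1984, App. B, after
(B.2.9) ("specified up to sign"). [cite: Wald1984GR, App. B (B.2.9)] -/
lemma IsMetricVolumeForm.neg {x : M} {ε : TangentSpace I x [⋀^Fin 4]→ₗ[ℝ] ℝ}
    (h : g.IsMetricVolumeForm x ε) : g.IsMetricVolumeForm x (-ε) := fun u v ↦ by
  simpa using h u v

variable [FiniteDimensional ℝ E] [CompleteSpace E] [Fact (1 ≤ n)] [g.HasLeviCivita]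

/-- `ϖ` is **the twist 1-form of `K` at `x`** with respect to the volume form `ε`: the covector with
`(K♭ ∧ dK♭)_x(u, v, w) = ε(u, v, w, ϖ♯)` for all `u, v, w`, where `K♭ ∧ dK♭` is the Frobenius `3`-form
`twistForm g K x` (`= 6 K_{[a} ∇_b K_{c]}`) and `♯` the musical isomorphism of `g_x`; i.e.
`ϖ = ⋆(K♭ ∧ dK♭)` up to the sign conventions of `⋆`. Unwinding Wald (B.2.13),
`6 K_{[a} ∇_b K_{c]} = ε_{abcd} ϖ^d` for `ϖ_a = ε_{abcd} K^b ∇^c K^d`, Wald's **twist** (7.1.8) (for a metric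
volume form `ε`; for `ε = 0` only hypersurface-orthogonal `K` have twist covectors).
Wald 1984, §7.1, (7.1.6)–(7.1.8). [cite: Wald1984GR, §7.1 (7.1.8)] -/
def IsTwistCovector (x : M) (ε : TangentSpace I x [⋀^Fin 4]→ₗ[ℝ] ℝ)
    (ϖ : TangentSpace I x →L[ℝ] ℝ) : Prop :=
  ∀ u v w : TangentSpace I x,
    g.twistForm K x u v w = ε ![u, v, w, g.sharp x (ϖ : TangentSpace I x →ₗ[ℝ] ℝ)]

open scoped Classical in
/-- **The twist 1-form** `ϖ_x = ⋆(K♭ ∧ dK♭)_x` of `K` with respect to the field of volume forms `ε`: a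
twist covector at `x` when one exists (it is then unique as soon as `ε_x ≠ 0`, `T_x M` being
`4`-dimensional), the junk value `0` otherwise (the pattern of the prelude's `hessian`). Wald 1984, §7.1,
(7.1.8) (`ω_a = ε_{abcd} ξ^b ∇^c ξ^d`). [cite: Wald1984GR, §7.1 (7.1.8)] -/
def twistCovector (ε : Π x : M, TangentSpace I x [⋀^Fin 4]→ₗ[ℝ] ℝ) (x : M) :
    TangentSpace I x →L[ℝ] ℝ :=
  if h : ∃ ϖ : TangentSpace I x →L[ℝ] ℝ, g.IsTwistCovector K x (ε x) ϖ then h.choose else 0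

/-- `f : M → ℝ` is a **twist potential** (scalar twist) of `K` on `U` with respect to `ε`: `f` is smooth
on `U` and `df_x` is the twist 1-form of `K` at every `x ∈ U` (`ω_a = ∇_a ω`). Wald 1984, §7.4, (7.4.3);
Choquet-Bruhat–Moncrief 2001, §2.1; Gudapati 2013, Ch. 2 (`G = dω`). [cite: Wald1984GR, §7.4 (7.4.3)] -/
def IsTwistPotentialOn (ε : Π x : M, TangentSpace I x [⋀^Fin 4]→ₗ[ℝ] ℝ) (f : M → ℝ) (U : Set M) :
    Prop :=
  ContMDiffOn I 𝓘(ℝ, ℝ) ∞ f U ∧ ∀ x ∈ U, g.IsTwistCovector K x (ε x) (mvfderiv I f x)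

variable {g K}

omit [CompleteSpace E] [Fact (1 ≤ n)] in
/-- A twist potential is smooth on its domain. [folklore] -/
lemma IsTwistPotentialOn.contMDiffOn {ε : Π x : M, TangentSpace I x [⋀^Fin 4]→ₗ[ℝ] ℝ} {f : M → ℝ}
    {U : Set M} (h : g.IsTwistPotentialOn K ε f U) : ContMDiffOn I 𝓘(ℝ, ℝ) ∞ f U := h.1

omit [CompleteSpace E] [Fact (1 ≤ n)] in
/-- The differential of a twist potential is the twist 1-form: `ω_a = ∇_a ω`. Wald 1984, §7.4, (7.4.3).
[cite: Wald1984GR, §7.4 (7.4.3)] -/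
lemma IsTwistPotentialOn.isTwistCovector {ε : Π x : M, TangentSpace I x [⋀^Fin 4]→ₗ[ℝ] ℝ}
    {f : M → ℝ} {U : Set M} (h : g.IsTwistPotentialOn K ε f U) {x : M} (hx : x ∈ U) :
    g.IsTwistCovector K x (ε x) (mvfderiv I f x) := h.2 x hx

omit [CompleteSpace E] [Fact (1 ≤ n)] in
/-- Twist potentials restrict to smaller sets. [folklore] -/
lemma IsTwistPotentialOn.mono {ε : Π x : M, TangentSpace I x [⋀^Fin 4]→ₗ[ℝ] ℝ} {f : M → ℝ}
    {U V : Set M} (h : g.IsTwistPotentialOn K ε f U) (hVU : V ⊆ U) : g.IsTwistPotentialOn K ε f V :=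
  ⟨h.1.mono hVU, fun x hx ↦ h.2 x (hVU hx)⟩

omit [CompleteSpace E] [Fact (1 ≤ n)] in
/-- Reversing the orientation reverses the twist: if `ϖ` is the twist covector for `ε` then `−ϖ` is the
twist covector for `−ε`. Wald 1984, §7.1, (7.1.8) (`ω_a` is linear in `ε`). [cite: Wald1984GR, §7.1 (7.1.8)] -/
lemma IsTwistCovector.neg {x : M} {ε : TangentSpace I x [⋀^Fin 4]→ₗ[ℝ] ℝ}
    {ϖ : TangentSpace I x →L[ℝ] ℝ} (h : g.IsTwistCovector K x ε ϖ) :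
    g.IsTwistCovector K x (-ε) (-ϖ) := fun u v w ↦ by
  have hs : g.sharp x ((-ϖ : TangentSpace I x →L[ℝ] ℝ) : TangentSpace I x →ₗ[ℝ] ℝ) =
      -g.sharp x (ϖ : TangentSpace I x →ₗ[ℝ] ℝ) := by
    rw [← map_neg]; rfl
  have key : ∀ z : TangentSpace I x, ε ![u, v, w, -z] = -ε ![u, v, w, z] := fun z ↦ by
    have h1 : ![u, v, w, -z] = Function.update ![u, v, w, z] 3 (-z) := by
      ext i; fin_cases i <;> simp
    have h2 : Function.update ![u, v, w, z] 3 z = ![u, v, w, z] := by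
      ext i; fin_cases i <;> simp
    rw [h1, AlternatingMap.map_update_neg, h2]
  rw [h u v w, hs, AlternatingMap.neg_apply, key, neg_neg]

omit [CompleteSpace E] [Fact (1 ≤ n)] in
/-- The zero covector is a twist covector of the zero vector field (for any `ε`). [folklore] -/
lemma isTwistCovector_zero (x : M) (ε : TangentSpace I x [⋀^Fin 4]→ₗ[ℝ] ℝ) :
    g.IsTwistCovector 0 x ε 0 := fun u v w ↦ by
  rw [twistForm_zero]
  have h0 : ![u, v, w, g.sharp x ((0 : TangentSpace I x →L[ℝ] ℝ) : TangentSpace I x →ₗ[ℝ] ℝ)] 3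
      = 0 := by simp
  exact (ε.map_coord_zero 3 h0).symm

omit [CompleteSpace E] [Fact (1 ≤ n)] in
/-- Defining property of `twistCovector`: it is a twist covector whenever one exists. Wald 1984, §7.1,
(7.1.8). [cite: Wald1984GR, §7.1 (7.1.8)] -/
lemma isTwistCovector_twistCovector {ε : Π x : M, TangentSpace I x [⋀^Fin 4]→ₗ[ℝ] ℝ} {x : M}
    (h : ∃ ϖ : TangentSpace I x →L[ℝ] ℝ, g.IsTwistCovector K x (ε x) ϖ) :
    g.IsTwistCovector K x (ε x) (g.twistCovector K ε x) := by
  rw [twistCovector, dif_pos h]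
  exact h.choose_spec

end Twist

/-! ### Local slices transverse to `K` carrying the reduced metric -/

section Slice

variable {E' : Type*} [NormedAddCommGroup E'] [NormedSpace ℝ E'] {H' : Type*} [TopologicalSpace H']
  {I' : ModelWithCorners ℝ E' H'} {N : Type*} [TopologicalSpace N] [ChartedSpace H' N]
  [IsManifold I' ∞ N] {n' : ℕ∞ω}

variable (g : PseudoRiemannianMetric I n E (TangentSpace I : M → Type _))
  (K : Π x : M, TangentSpace I x)

/-- `(N, g₃) —φ→ (M, g, K)` is a **reduced slice** (a local `U(1)`-reduction chart): `φ` is a smooth map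
from a manifold of one dimension less whose pullback of the reduced form `λ g − K♭ ⊗ K♭` is the
pseudo-Riemannian metric `g₃` of `N`. Then every `dφ_y` is injective with image transverse to `K`
(`IsReducedSlice.mfderiv_injective`, `.eq_zero_of_mfderiv_eq_smul`), i.e. `φ` is an immersed local
slice of the `K`-action and `(N, g₃)` is an open piece of the orbit space with Moncrief's metric `⁽³⁾g`
(Geroch's `λ h`). This replaces the quotient manifold `Σ × ℝ = V / U(1)` of the sources by local
transversals. Geroch 1971, App. A; Choquet-Bruhat–Moncrief 2001, §2. [cite: ChoquetbruhatMoncrief2001, §2] -/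
structure IsReducedSlice (φ : N → M)
    (g₃ : PseudoRiemannianMetric I' n' E' (TangentSpace I' : N → Type _)) : Prop where
  /-- the slice map is smooth -/
  contMDiff : ContMDiff I' I ∞ φ
  /-- the slice has codimension one -/
  finrank_succ : Module.finrank ℝ E' + 1 = Module.finrank ℝ E
  /-- the metric of `N` is the pullback of `λ g − K♭ ⊗ K♭` -/
  pullback_reducedBilin : ∀ y : N, pullbackBilin (I := I) (I' := I') φ (g.reducedBilin K) y = g₃.val y

variable {g K} {φ : N → M} {g₃ : PseudoRiemannianMetric I' n' E' (TangentSpace I' : N → Type _)}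

/-- On a reduced slice, `g₃(v, w) = λ g(dφ v, dφ w) − g(K, dφ v) g(K, dφ w)`.
Choquet-Bruhat–Moncrief 2001, §2. [cite: ChoquetbruhatMoncrief2001, §2] -/
lemma IsReducedSlice.val_apply (h : g.IsReducedSlice K φ g₃) (y : N) (v w : TangentSpace I' y) :
    g₃.val y v w = g.reducedBilin K (φ y) (mfderiv I' I φ y v) (mfderiv I' I φ y w) := by
  rw [← h.pullback_reducedBilin y, pullbackBilin_apply]

/-- The differential of a reduced slice is injective (`g₃` is nondegenerate), so `φ` is an immersion.
[folklore] -/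
lemma IsReducedSlice.mfderiv_injective (h : g.IsReducedSlice K φ g₃) (y : N) :
    Function.Injective (mfderiv I' I φ y) := by
  intro v w hvw
  have h0 : ∀ z, g₃.val y (v - w) z = 0 := fun z ↦ by
    rw [h.val_apply, map_sub, hvw, sub_self, map_zero]; rfl
  exact sub_eq_zero.mp (g₃.nondegenerate y _ h0)

/-- A reduced slice is transverse to `K`: no nonzero tangent vector of `N` is mapped into the line
`ℝ K` (`K` is in the kernel of `λ g − K♭ ⊗ K♭`, `g₃` is nondegenerate). Geroch 1971, App. A. [folklore] -/
lemma IsReducedSlice.eq_zero_of_mfderiv_eq_smul (h : g.IsReducedSlice K φ g₃) {y : N}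
    {v : TangentSpace I' y} {c : ℝ} (hv : mfderiv I' I φ y v = c • K (φ y)) : v = 0 := by
  refine g₃.nondegenerate y v fun z ↦ ?_
  rw [h.val_apply, hv, map_smul]
  change c • g.reducedBilin K (φ y) (K (φ y)) (mfderiv I' I φ y z) = 0
  rw [reducedBilin_apply_self_left, smul_zero]

end Slice

/-! ### The Einstein–wave-map system with hyperbolic target -/

section EinsteinWaveMap

variable [FiniteDimensional ℝ E] [CompleteSpace E] [Fact (1 ≤ n)]
  (g : PseudoRiemannianMetric I n E (TangentSpace I : M → Type _)) [g.HasLeviCivita]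

/-- The **Einstein–wave-map system with target `(ℝ², h)` at the point `x`** for the metric `g` (in
practice the reduced Lorentzian `3`-metric) and the map `u = (γ, ω) : M → ℝ²` (binders `γ ϑ`; `ϑ` is the
`ω` of the sources), `h = 2 dγ² + ½ e^{−4γ} dω²`:
(E1) `Ric(g)_x(v, w) = h_{u(x)}(du v, du w) = 2 dγ(v) dγ(w) + ½ e^{−4γ} dω(v) dω(w)` (the Einstein equation
`G = S` in Ricci form, `κ = 1`); (E2) `□_g γ + ½ e^{−4γ} g⁻¹(dω, dω) = 0` and
(E3) `□_g ω − 4 g⁻¹(dγ, dω) = 0` (the two components of the wave-map equation, the Christoffel symbols of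
`h` being `Γ^γ_{ωω} = ½ e^{−4γ}`, `Γ^ω_{γω} = −2`). Here `d = mvfderiv`, `□ = dalembertian`,
`g⁻¹ = innerDual`. Gudapati 2013, Ch. 2, pp. 14–15 (the displayed system); Choquet-Bruhat–Moncrief 2001,
§2.2–2.3, eq. (1); Andersson–Gudapati–Szeftel 2017, §1.2. [cite: Gudapati2013, Ch. 2, pp. 14–15] -/
def IsEinsteinWaveMapAt (γ ϑ : M → ℝ) (x : M) : Prop :=
  (∀ v w : TangentSpace I x, g.ricci x v w =
      U1Reduction.targetMetric (γ x, ϑ x) (mvfderiv I γ x v, mvfderiv I ϑ x v)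
        (mvfderiv I γ x w, mvfderiv I ϑ x w)) ∧
    g.dalembertian γ x + Real.exp (-4 * γ x) / 2 *
        g.innerDual x (mvfderiv I ϑ x : TangentSpace I x →ₗ[ℝ] ℝ)
          (mvfderiv I ϑ x : TangentSpace I x →ₗ[ℝ] ℝ) = 0 ∧
    g.dalembertian ϑ x - 4 * g.innerDual x (mvfderiv I γ x : TangentSpace I x →ₗ[ℝ] ℝ)
        (mvfderiv I ϑ x : TangentSpace I x →ₗ[ℝ] ℝ) = 0

/-- `(M, g, (γ, ω))` is an **Einstein–wave-map spacetime with target the hyperbolic plane**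
`(ℝ², 2 dγ² + ½ e^{−4γ} dω²)`: `γ, ω` (binders `γ ϑ`) are `C^n` and the system `IsEinsteinWaveMapAt`
holds at every point. (For a `3`-dimensional Lorentzian `(M, g)` this is the `2+1` Einstein–wave-map system whose Cauchy
problem is studied by Andersson–Gudapati–Szeftel.) Andersson–Gudapati–Szeftel 2017, §1.2 (the system
`G_{μν} = κ S_{μν}` coupled to the wave-map equation; here `κ = 1`, Ricci form — equivalent to
`G = S` by taking the trace in dimension `≠ 2` — and target `ℍ²` in the coordinates `(γ, ω)`);
Gudapati 2013, Ch. 2, p. 15. [cite: AnderssonGudapatiSzeftel2017, §1.2] -/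
def IsEinsteinWaveMap (γ ϑ : M → ℝ) : Prop :=
  ContMDiff I 𝓘(ℝ, ℝ) n γ ∧ ContMDiff I 𝓘(ℝ, ℝ) n ϑ ∧ ∀ x, g.IsEinsteinWaveMapAt γ ϑ x

variable {g}

omit [CompleteSpace E] [Fact (1 ≤ n)] in
/-- Unfolding lemma for `IsEinsteinWaveMap`. [folklore] -/
lemma IsEinsteinWaveMap.isEinsteinWaveMapAt {γ ϑ : M → ℝ} (h : g.IsEinsteinWaveMap γ ϑ) (x : M) :
    g.IsEinsteinWaveMapAt γ ϑ x := h.2.2 x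

omit [CompleteSpace E] [Fact (1 ≤ n)] in
/-- The Einstein equation (E1) of the system: `Ric(g)(v, w) = h(du v, du w)`. Choquet-Bruhat–Moncrief
2001, §2.3, eq. (1). [cite: ChoquetbruhatMoncrief2001, §2.3 eq. (1)] -/
lemma IsEinsteinWaveMapAt.ricci_apply {γ ϑ : M → ℝ} {x : M} (h : g.IsEinsteinWaveMapAt γ ϑ x)
    (v w : TangentSpace I x) :
    g.ricci x v w = 2 * mvfderiv I γ x v * mvfderiv I γ x w +
      Real.exp (-4 * γ x) / 2 * mvfderiv I ϑ x v * mvfderiv I ϑ x w := by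
  rw [h.1 v w, U1Reduction.targetMetric_apply]

end EinsteinWaveMap

end PseudoRiemannianMetric

/-! ### The reduction theorems (named facts, D-0014) -/

namespace LorentzianMetric

variable {E : Type*} [NormedAddCommGroup E] [NormedSpace ℝ E] {H : Type*} [TopologicalSpace H]
  {I : ModelWithCorners ℝ E H} {M : Type*} [TopologicalSpace M] [ChartedSpace H M]
  [IsManifold I ∞ M]
  {E' : Type*} [NormedAddCommGroup E'] [NormedSpace ℝ E'] {H' : Type*} [TopologicalSpace H']
  {I' : ModelWithCorners ℝ E' H'} {N : Type*} [TopologicalSpace N] [ChartedSpace H' N]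
  [IsManifold I' ∞ N]
  (g : LorentzianMetric I ∞ M) (K : Π x : M, TangentSpace I x)

/-- **Twist potentials exist locally when `Ric(K, ·) = 0`** (in particular in vacuum). Let `g` be a
smooth Lorentzian metric on a (boundaryless) `4`-manifold, `K` a Killing field and `U` an open set on
which `Ric(g)(K, ·) = 0`. Then every `x₀ ∈ U` has an open neighbourhood `V ⊆ U` carrying a metric
volume form `ε` and a smooth function `f` with `df = ϖ(ε)` (the twist 1-form of `K`) on `V`: by Wald
(7.1.15), `∇_{[a} ω_{b]} = −ε_{abcd} ξ^c R^d{}_e ξ^e = 0`, so locally `ω_a = ∇_a ω` (Poincaré lemma), `ε`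
being either local orientation. Wald 1984, §7.1, (7.1.15) and §7.4, (7.4.1)–(7.4.3); Geroch 1971, §2.
[cite: Wald1984GR, §7.4 (7.4.2)–(7.4.3)] -/
def exists_twistPotential (U : Set M) : Prop :=
  ∀ [I.Boundaryless] [FiniteDimensional ℝ E] [CompleteSpace E] [g.HasLeviCivita],
    Module.finrank ℝ E = 4 → IsOpen U → g.IsKillingField K →
    (∀ x ∈ U, ∀ v : TangentSpace I x, g.ricci x (K x) v = 0) →
    ∀ x₀ ∈ U, ∃ V : Set M, IsOpen V ∧ x₀ ∈ V ∧ V ⊆ U ∧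
      ∃ (ε : Π x : M, TangentSpace I x [⋀^Fin 4]→ₗ[ℝ] ℝ) (f : M → ℝ),
        (∀ x ∈ V, g.IsMetricVolumeForm x (ε x)) ∧ g.IsTwistPotentialOn K ε f V

/-- **The Geroch–Moncrief reduction identity.** Let `g` be a smooth Lorentzian metric on a
(boundaryless) `4`-manifold `M`, `K` a Killing field which is spacelike and nonzero (`λ = g(K,K) > 0`)
on an open set `U`, `ε` a metric volume form and `f` a smooth twist potential of `K` on `U`
(`df = ϖ(ε)`), and let `(N, g₃) —φ→ U` be a reduced slice (`N` boundaryless,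
`φ^*(λ g − K♭ ⊗ K♭) = g₃`, `dim N = 3`). Put `γ = ½ log λ`. Then at every `y ∈ N`: **`Ric(g) = 0` at
`φ(y)` if and only if `(g₃, (γ ∘ φ, f ∘ φ))` satisfies at `y` the `2+1` Einstein–wave-map system with
target `(ℝ², 2 dγ² + ½ e^{−4γ} dω²)`** — `Ric(g₃) = 2 dγ ⊗ dγ + ½ e^{−4γ} dω ⊗ dω`,
`□γ + ½ e^{−4γ} |dω|² = 0`, `□ω − 4 ⟨dγ, dω⟩ = 0`. (Forward: the Kaluza–Klein decomposition of
`Ric(⁽⁴⁾g)` for `⁽⁴⁾g = e^{−2γ} ⁽³⁾g + e^{2γ}(dx³ + A)²` in a chart with `K = ∂₃`, `dA` being `⋆`-dual to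
`e^{−4γ} dω`; backward: the same identities, `⁽⁴⁾R_{α3} = 0` coming from `d(df) = 0` and (7.1.15); the
third equation is the Bianchi identity `ddA = 0` and holds for every twist potential.) Moncrief 1986,
§2; Choquet-Bruhat–Moncrief 2001, §2.1–2.3 (eq. (1)); Gudapati 2013, Ch. 2, pp. 14–15; Geroch 1971,
App. A; Andersson–Gudapati–Szeftel 2017, Remark 1.2. [cite: Moncrief1986, §2] -/
def ricci_eq_zero_iff_isEinsteinWaveMapAt (ε : Π x : M, TangentSpace I x [⋀^Fin 4]→ₗ[ℝ] ℝ)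
    (f : M → ℝ) (U : Set M) (g₃ : PseudoRiemannianMetric I' ∞ E' (TangentSpace I' : N → Type _))
    (φ : N → M) : Prop :=
  ∀ [I.Boundaryless] [I'.Boundaryless] [FiniteDimensional ℝ E] [CompleteSpace E] [g.HasLeviCivita]
    [FiniteDimensional ℝ E'] [CompleteSpace E'] [g₃.HasLeviCivita],
    Module.finrank ℝ E = 4 → IsOpen U → (∀ y, φ y ∈ U) → g.IsKillingField K →
    (∀ x ∈ U, 0 < g.sqNorm K x) → (∀ x ∈ U, g.IsMetricVolumeForm x (ε x)) →
    g.IsTwistPotentialOn K ε f U → g.IsReducedSlice K φ g₃ →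
    ∀ y : N, g.ricci (φ y) = 0 ↔
      g₃.IsEinsteinWaveMapAt (g.normPotential K ∘ φ) (f ∘ φ) y

/-- **Local reduced slices exist.** Let `g` be a smooth Lorentzian metric on a boundaryless `4`-manifold
and `K` a smooth vector field with `g(K, K) > 0` at `x₀`. Then through `x₀` passes a reduced slice
modelled on an open subset `V` of `ℝ³`, whose metric `g₃ = φ^*(λ g − K♭ ⊗ K♭)` is Lorentzian: a chart
transversal to `K` at `x₀`, shrunk so that `λ > 0` and `dφ(T V) ⊕ ℝ K = T M` along it; `λ g − K♭ ⊗ K♭`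
restricted to a complement of the spacelike line `ℝ K` is `λ g|_{K^⊥}`, of signature `(−,+,+)`. This is
the local content of Geroch's orbit-space construction (`S` a `3`-manifold with Lorentzian metric `h` when
`ξ` is spacelike), Geroch 1971, App. A; Choquet-Bruhat–Moncrief 2001, §2 (`⁽³⁾g` Lorentzian). [cite: Geroch1971, App. A] -/
def exists_isReducedSlice (x₀ : M) : Prop :=
  ∀ [I.Boundaryless], Module.finrank ℝ E = 4 → CMDiff ∞ (T% K) → 0 < g.sqNorm K x₀ →
    ∃ (V : Opens E3) (g₃ : LorentzianMetric (𝓡 3) ∞ V) (φ : V → M),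
      x₀ ∈ Set.range φ ∧ g.IsReducedSlice (I' := 𝓡 3) K φ g₃.toPseudoRiemannianMetric

variable {g K}

/-- **Vacuum `⇒` Einstein–wave map** (the direction used by the route): under the hypotheses of the
reduction identity, if `g` is Ricci-flat then the reduced data `(g₃, γ ∘ φ, f ∘ φ)` of every reduced slice
solve the `2+1` Einstein–wave-map system at every point. Immediate from the named fact
`ricci_eq_zero_iff_isEinsteinWaveMapAt` (hypothesis `h`). Moncrief 1986, §2; Andersson–Gudapati–Szeftel
2017, Remark 1.2. [cite: Moncrief1986, §2] -/
theorem isEinsteinWaveMapAt_of_isRicciFlat [I.Boundaryless] [I'.Boundaryless] [FiniteDimensional ℝ E]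
    [CompleteSpace E] [g.HasLeviCivita] [FiniteDimensional ℝ E'] [CompleteSpace E']
    {ε : Π x : M, TangentSpace I x [⋀^Fin 4]→ₗ[ℝ] ℝ} {f : M → ℝ} {U : Set M}
    {g₃ : PseudoRiemannianMetric I' ∞ E' (TangentSpace I' : N → Type _)} [g₃.HasLeviCivita] {φ : N → M}
    (h : g.ricci_eq_zero_iff_isEinsteinWaveMapAt K ε f U g₃ φ) (hE : Module.finrank ℝ E = 4)
    (hU : IsOpen U) (hφU : ∀ y, φ y ∈ U) (hK : g.IsKillingField K) (hpos : ∀ x ∈ U, 0 < g.sqNorm K x)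
    (hε : ∀ x ∈ U, g.IsMetricVolumeForm x (ε x)) (hf : g.IsTwistPotentialOn K ε f U)
    (hφ : g.IsReducedSlice K φ g₃) (hRic : g.IsRicciFlat) (y : N) :
    g₃.IsEinsteinWaveMapAt (g.normPotential K ∘ φ) (f ∘ φ) y :=
  (h hE hU hφU hK hpos hε hf hφ y).mp (hRic (φ y))

end LorentzianMetric

end Literature.Geometry.Lorentzian

end
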